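import Summits.CriticalPhenomena.PercolationContinuityZ3.Theorems.PercNearOneGluingNoHeavyLowerTailSahiJuntaSlotCerts

/-!
# `NoHeavyLowerTail` (crux stmt-CriticalPhenomena-4575): KAHN'S CONJECTURE 5 / SAHI'S `C₃` FOR THE FIRST SLOTS `a ∨ (b ∧ c)` AND
# MAJORITY — hence for EVERY increasing event depending on at most three coordinates, the other two slots ARBITRARY

Support file (cell `prim-l12`, seat P3 = Ahlswede–Daykin / four functions, gen 4; `--supports stmt-CriticalPhenomena-4575`).
No `sorry`, no named facts, standard axioms (the certificates are kernel-checked by `decide +kernel`).  New mathematics, not in print.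

**THEOREMS.**  For every finite `ι`, every product weight `μ_p` on `2^ι`, three distinct coordinates `a, b, c ∈ ι`, and ALL increasing events
`U, V ⊆ 2^ι`:
* `sahiE_three_orAnd_nonneg`:  `E₃(1_H, 1_U, 1_V) ≥ 0` for `H = {ω | a ∈ ω ∨ (b ∈ ω ∧ c ∈ ω)}`;
* `sahiE_three_maj_nonneg`:    `E₃(1_H, 1_U, 1_V) ≥ 0` for `H = {ω | two of a, b, c lie in ω}` (majority);
and the law forms `prodBernoulli_sahiE3_orAnd_nonneg`, `prodBernoulli_sahiE3_maj_nonneg`.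
Together with the tree's cylinder (`…SahiCombStrata`), hitting (`…SahiHittingSlot`) and cylinder-∩-hitting (`…SahiHittingSlotCylinder`) slots these
exhaust the eight isomorphism types `x, xy, xyz, x∨y, x∨y∨z, x(y∨z), x∨yz, maj` of increasing events on three coordinates: Kahn's
Conjecture 5 [Kahn2022, Conj. 5] = Sahi's `C₃` for product measures [Sahi2008, Conj. 5] holds whenever ONE of the three increasing events depends on
at most three coordinates, in every dimension.

PROOF = the transport-certificate method of this seat (`…SahiTransportSections`, `…SahiTransportCert`): a kernel `Π` on the pattern cube `2^3`
moving the negative outer-covariance mass of `Hᶜ`-patterns up into `H`, with the transport condition checked for all `20 × 20` pairs of up-sets of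
`2^3` by the Richards-comb digit test (`…SahiTransportCheck`, `…SahiTransportCheckCols`), assembled in `…SahiJuntaSlotCube`/`…SahiJuntaSlotCerts`.
The certificates (HOME run/shared/lean/prim/prim-l12/prim-l12-p3, memo FROM-prim-l12-p3-g4-TRANSPORT-CERT.md):
`a ∨ bc`: `Π(∅,a) = w(∅)p_a, Π(∅,bc) = w(∅)w(bc), Π(b,ab) = w(b)p_a, Π(b,bc) = w(b)w(bc), Π(c,ac) = w(c)p_a, Π(c,bc) = w(c)w(bc)`;
majority: `Π(∅,m) = w(∅)(w(m) + w(abc)/3)`, `Π(x, x∪y) = w(x)(w(xy) + (w(abc) + w(m̄_x))/2)`.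
[cite: Kahn2022, Conj. 5 (arXiv p. 3); Sahi2008, Conj. 5; LiebSahi2021, eq. (2.1)]
-/

noncomputable section

open scoped Classical

namespace Summit.CriticalPhenomena.PercolationContinuityZ3.Theorems

namespace SahiJuntaSlotThree

open Finset
open SahiHittingSlot SahiTransportCert SahiTransportCheck SahiC3Cube
open Literature.Combinatorics.Sahi2008
open Literature.Probability.LatticeModels (prodBernoulli sahiE3)
open Literature.Probability.Percolation (DeterminedBy determinedBy_iff)
open Literature.Probability.Percolation.DecisionTree (ind ind_of_mem ind_of_not_mem ind_nonneg)

variable {ι : Type}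

/-! ### Three distinct coordinates as a block `Fin 3 ↪ ι` -/

/-- Three distinct coordinates give an injective enumeration. [this work] -/
theorem injective_three {a b c : ι} (hab : a ≠ b) (hac : a ≠ c) (hbc : b ≠ c) : Function.Injective ![a, b, c] := by
  intro i j h
  fin_cases i <;> fin_cases j <;> simp at h ⊢
  all_goals first | exact hab h | exact hab h.symm | exact hac h | exact hac h.symm | exact hbc h | exact hbc h.symm

/-- The block `e = (a, b, c)`. [this work] -/
def e3 {a b c : ι} (hab : a ≠ b) (hac : a ≠ c) (hbc : b ≠ c) : Fin 3 ↪ ι := ⟨![a, b, c], injective_three hab hac hbc⟩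

/-- Membership of `a, b, c` in an image of the block. [this work] -/
theorem mem_image_e3 {a b c : ι} (hab : a ≠ b) (hac : a ≠ c) (hbc : b ≠ c) (S : Set (Fin 3)) :
    (a ∈ (e3 hab hac hbc : Fin 3 → ι) '' S ↔ (0 : Fin 3) ∈ S) ∧ (b ∈ (e3 hab hac hbc : Fin 3 → ι) '' S ↔ (1 : Fin 3) ∈ S) ∧
      (c ∈ (e3 hab hac hbc : Fin 3 → ι) '' S ↔ (2 : Fin 3) ∈ S) := by
  exact ⟨(e3 hab hac hbc).injective.mem_set_image (a := (0 : Fin 3)) (s := S),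
    (e3 hab hac hbc).injective.mem_set_image (a := (1 : Fin 3)) (s := S),
    (e3 hab hac hbc).injective.mem_set_image (a := (2 : Fin 3)) (s := S)⟩

/-- An event described by memberships of `a, b, c` is determined by the block. [this work] -/
theorem determinedBy_of_abc {a b c : ι} (hab : a ≠ b) (hac : a ≠ c) (hbc : b ≠ c) (P : Prop → Prop → Prop → Prop) :
    DeterminedBy {ω : Set ι | P (a ∈ ω) (b ∈ ω) (c ∈ ω)} (Set.range (e3 hab hac hbc)) := by
  rw [determinedBy_iff]
  intro ω ω' h
  have key : ∀ x ∈ Set.range (e3 hab hac hbc), x ∈ ω ↔ x ∈ ω' := fun x hx => by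
    constructor
    · intro hω; exact ((Set.ext_iff.1 h x).1 ⟨hω, hx⟩).1
    · intro hω'; exact ((Set.ext_iff.1 h x).2 ⟨hω', hx⟩).1
  have ha := key a ⟨0, rfl⟩
  have hb := key b ⟨1, rfl⟩
  have hc := key c ⟨2, rfl⟩
  simp only [Set.mem_setOf_eq]
  rw [ha, hb, hc]

/-! ### The two first slots -/

/-- `H = {ω | a ∈ ω ∨ (b ∈ ω ∧ c ∈ ω)}` — the `a ∨ bc` event. [this work] -/
def HOrAnd (a b c : ι) : Set (Set ι) := {ω | a ∈ ω ∨ (b ∈ ω ∧ c ∈ ω)}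

/-- `H = {ω | two of a, b, c ∈ ω}` — the majority event. [this work] -/
def HMaj (a b c : ι) : Set (Set ι) := {ω | (a ∈ ω ∧ b ∈ ω) ∨ (a ∈ ω ∧ c ∈ ω) ∨ (b ∈ ω ∧ c ∈ ω)}

/-- `HOrAnd` is increasing. [this work] -/
theorem isUpperSet_HOrAnd (a b c : ι) : IsUpperSet (HOrAnd a b c) := by
  intro ω ω' hle h
  simp only [HOrAnd, Set.mem_setOf_eq] at h ⊢
  rcases h with h | ⟨h1, h2⟩
  · exact Or.inl (hle h)
  · exact Or.inr ⟨hle h1, hle h2⟩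

/-- `HMaj` is increasing. [this work] -/
theorem isUpperSet_HMaj (a b c : ι) : IsUpperSet (HMaj a b c) := by
  intro ω ω' hle h
  simp only [HMaj, Set.mem_setOf_eq] at h ⊢
  rcases h with ⟨h1, h2⟩ | ⟨h1, h2⟩ | ⟨h1, h2⟩
  · exact Or.inl ⟨hle h1, hle h2⟩
  · exact Or.inr (Or.inl ⟨hle h1, hle h2⟩)
  · exact Or.inr (Or.inr ⟨hle h1, hle h2⟩)

/-- `HOrAnd` is determined by the block. [this work] -/
theorem determinedBy_HOrAnd {a b c : ι} (hab : a ≠ b) (hac : a ≠ c) (hbc : b ≠ c) :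
    DeterminedBy (HOrAnd a b c) (Set.range (e3 hab hac hbc)) :=
  determinedBy_of_abc hab hac hbc fun x y z => x ∨ (y ∧ z)

/-- `HMaj` is determined by the block. [this work] -/
theorem determinedBy_HMaj {a b c : ι} (hab : a ≠ b) (hac : a ≠ c) (hbc : b ≠ c) :
    DeterminedBy (HMaj a b c) (Set.range (e3 hab hac hbc)) :=
  determinedBy_of_abc hab hac hbc fun x y z => (x ∧ y) ∨ (x ∧ z) ∨ (y ∧ z)

/-- The pattern event of `HOrAnd` is the bitmask event `234 = {a, ab, ac, bc, abc}`. [this work] -/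
theorem pat_HOrAnd {a b c : ι} (hab : a ≠ b) (hac : a ≠ c) (hbc : b ≠ c) : pat (e3 hab hac hbc) (HOrAnd a b c) = HkM 234 := by
  ext S
  obtain ⟨h0, h1, h2⟩ := mem_image_e3 hab hac hbc S
  rw [mem_pat, mem_HkM]
  simp only [HOrAnd, Set.mem_setOf_eq, h0, h1, h2, mem_iff_testBit_code S]
  have hc := code_lt S
  generalize code S = k at *
  interval_cases k <;> decide

/-- The pattern event of `HMaj` is the bitmask event `232 = {ab, ac, bc, abc}`. [this work] -/
theorem pat_HMaj {a b c : ι} (hab : a ≠ b) (hac : a ≠ c) (hbc : b ≠ c) : pat (e3 hab hac hbc) (HMaj a b c) = HkM 232 := by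
  ext S
  obtain ⟨h0, h1, h2⟩ := mem_image_e3 hab hac hbc S
  rw [mem_pat, mem_HkM]
  simp only [HMaj, Set.mem_setOf_eq, h0, h1, h2, mem_iff_testBit_code S]
  have hc := code_lt S
  generalize code S = k at *
  interval_cases k <;> decide

/-! ### The theorems -/

section Measure

variable [Fintype ι]

/-- **KAHN'S CONJECTURE 5 / SAHI'S `C₃` FOR THE FIRST SLOT `a ∨ (b ∧ c)`, the other two slots arbitrary increasing events, every
dimension.** [this work] -/
theorem sahiE_three_orAnd_nonneg (p : ι → unitInterval) {a b c : ι} (hab : a ≠ b) (hac : a ≠ c) (hbc : b ≠ c) {U V : Set (Set ι)}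
    (hU : IsUpperSet U) (hV : IsUpperSet V) : 0 ≤ sahiE (bernoulliWeight p) 3 ![ind (HOrAnd a b c), ind U, ind V] := by
  have hcert : TransportCert (pk (e3 hab hac hbc) p) (pat (e3 hab hac hbc) (HOrAnd a b c)) (KrOrAnd (pk (e3 hab hac hbc) p)) := by
    rw [pat_HOrAnd]; exact transportCert_orAnd _
  exact sahiE_three_nonneg_of_transportCert p (e3 hab hac hbc) (determinedBy_HOrAnd hab hac hbc) hcert hU hV

/-- **KAHN'S CONJECTURE 5 / SAHI'S `C₃` FOR THE MAJORITY FIRST SLOT `maj(a,b,c)`, the other two slots arbitrary increasing events, every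
dimension.** [this work] -/
theorem sahiE_three_maj_nonneg (p : ι → unitInterval) {a b c : ι} (hab : a ≠ b) (hac : a ≠ c) (hbc : b ≠ c) {U V : Set (Set ι)}
    (hU : IsUpperSet U) (hV : IsUpperSet V) : 0 ≤ sahiE (bernoulliWeight p) 3 ![ind (HMaj a b c), ind U, ind V] := by
  have hcert : TransportCert (pk (e3 hab hac hbc) p) (pat (e3 hab hac hbc) (HMaj a b c)) (KrMaj (pk (e3 hab hac hbc) p)) := by
    rw [pat_HMaj]; exact transportCert_maj _
  exact sahiE_three_nonneg_of_transportCert p (e3 hab hac hbc) (determinedBy_HMaj hab hac hbc) hcert hU hV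

/-- Law form: `sahiE3 (prodBernoulli p) H U V ≥ 0` for the `a ∨ bc` slot. [this work] -/
theorem prodBernoulli_sahiE3_orAnd_nonneg (p : ι → unitInterval) {a b c : ι} (hab : a ≠ b) (hac : a ≠ c) (hbc : b ≠ c)
    {U V : Set (Set ι)} (hU : IsUpperSet U) (hV : IsUpperSet V) : 0 ≤ sahiE3 (prodBernoulli p) (HOrAnd a b c) U V := by
  rw [← sahiE_three_ind]; exact sahiE_three_orAnd_nonneg p hab hac hbc hU hV

/-- Law form: `sahiE3 (prodBernoulli p) H U V ≥ 0` for the majority slot. [this work] -/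
theorem prodBernoulli_sahiE3_maj_nonneg (p : ι → unitInterval) {a b c : ι} (hab : a ≠ b) (hac : a ≠ c) (hbc : b ≠ c)
    {U V : Set (Set ι)} (hU : IsUpperSet U) (hV : IsUpperSet V) : 0 ≤ sahiE3 (prodBernoulli p) (HMaj a b c) U V := by
  rw [← sahiE_three_ind]; exact sahiE_three_maj_nonneg p hab hac hbc hU hV

end Measure

end SahiJuntaSlotThree

end Summit.CriticalPhenomena.PercolationContinuityZ3.Theorems
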